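import Summits.QuantumFields.YangMills.Theorems.UnitScaleTiltProp7Lane2OverlapRows
import Summits.QuantumFields.YangMills.Theorems.UnitScaleTiltProp7Lane2PatchCommutatorRows
import Summits.QuantumFields.YangMills.Theorems.UnitScaleTiltProp7DivRecoveryCutoffReadings
import HarnessLib

/-!
# Route `UnitScaleTilt`, crux «MinimiserStabilityRegPr» (stmt-QuantumFields-19200), E′ ∕ (N06) LANE II «DIVERGENCE RECOVERY AT CURVED `W`» — (FAM):
# THE SEVEN FAMILY ROWS OF THE FROZEN `hPatch` FROM THE PACKAGE'S TWO LOCAL ROWS «`ζ_c = 0` OFF `Zc`» AND «AT MOST `8` CUTOFFS ALIVE AT A SITE»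

Cell `ym3-torus`, width seat `ym3-torus-px12` (gen 9); explicit-unit helper, `--supports stmt-QuantumFields-19200`, count-neutral.  YM₃ on T³ is a ladder rung (R3) —
NOT d = 4, NOT infinite volume, NOT a mass gap, NOT the Clay problem; nothing here claims `hPatch`, (B7), (REC), `hN06`, a stub or the crux.

THE POINT.  The last seven conjuncts of the hypothesis `hPatch` of ✓`Prop7DivRecoveryPatchesToRows.hRows_of_core_and_patches` (tree lines :84–:90) are FAMILY rows
`‖Σ_i f_i‖² ≤ ν·Σ_i X_i` ∕ `H(Σ_i f_i) ≤ ν·Σ_i X_i` over the index `i : Site (F.P K) 0` of the cutoff package ✓`Prop7Lane2CutoffPackage.exists_cutoffPackage`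
(cutoffs `Z := Zs`, `ZE := Zb` with the (Z2) readings `toL2S⁻¹(Zs c φ) x = ζ c x • toL2S⁻¹ φ x`, `toL2⁻¹(Zb c f) b = ζ c b.src • toL2⁻¹ f b`), for the seven families
`ZE_i(r_i)` (`Sr`), `D_W(Z_i φ_i) − ZE_i(D_W φ_i)` (`SM`), `H` of both (`SHr`, `SHM`), `Δ_W(Z_i φ_i) − Z_i(Δ_W φ_i)` (`SL`), `Z_i(κs_i)` (`SK`), `Z_i(φ_i)` (`SΦ`).
✓`Prop7Lane2OverlapRows` proves such rows for families of bounded pointwise (resp. 1-collared) MULTIPLICITY.  This file discharges the multiplicities from the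
package's two LOCAL rows ALONE — `hoff : ∀ c ∉ Zc, ζ c = 0` and `hcard : ∀ x, #{c ∈ Zc : ζ c x ≠ 0} ≤ 8` — with ABSOLUTE constants and no reference to the support
radius, the centres, the grid, `L`, `s`, `K`, `n` or `W`:
* a cutoff family `Zb_c(g_c)` ∕ `Zs_c(φ_c)` is alive at a bond ∕ site only where `ζ_c` is alive there ⇒ multiplicity `≤ 8` (§2);
* the gradient commutator at `b` is `(ℓ(ζ_c(b₊) − ζ_c(b₋)))•Ad(W_b)φ_c(b₊)` (✓`Prop7Lane2PatchCommutatorRows.gradComm_apply_eq_zero`), alive only if `ζ_c` is alive at `b₋`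
  or `b₊` ⇒ `≤ 16`; the Laplacian commutator at `x` is alive only if `ζ_c` is alive at one of the seven sites `x, x ± e_μ` (✓`lapComm_apply_eq_zero`) ⇒ `≤ 56` (§3);
* for the local energy `H f := c₀ℓ²·CURL_HS(f) + ‖D*_W f‖²` (✓`localEnergy_sum_le_of_overlap`, 1-collared support sets `Ω_c`): `Ω_c :=` the sites within one step of an
  alive site of `ζ_c` for `Zb_c(g_c)` (`≤ 7·8 = 56`), within two steps for the gradient commutators (`≤ 49·8 = 392`) (§4);
* §5 restates the seven rows in `hPatch`'s EXACT shape `… ≤ ν * ∑ i, X i` for any per-patch letters `X` dominating the members and any `ν ≥ 392`, so the knit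
  (★p1's Patches2, `hPatch_holds`) closes :84–:90 by `exact` with ONE `ν := max 392 ν_resource`.
The three RESOURCE rows :81–:83 (`ΣNi ∕ ΣCui ∕ ΣAsi`) are NOT touched: they need the chart-box multiplicity over the grid ((Z0)∕(hT_c), px4∕px9).

HONEST SCOPE.  Finite counting + the landed overlap rows; nothing of `hPatch`∕(B7)∕(REC)∕hN06∕the crux is proved or claimed.

References: T. Bałaban, CMP 99 (1985) 389–434 [Balaban1985BackgroundPropagators] ((3.11) p.392, (3.19)–(3.26) pp.393–395, (3.100) pp.413–414); CMP 96 (1984) 223–250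
[Balaban1984PropagatorsII] (p.238: «the sum over the partition of unity is locally finite, uniformly»).
-/

set_option autoImplicit false

noncomputable section

open scoped BigOperators Matrix.Norms.L2Operator Matrix

namespace Summit.QuantumFields.YangMills.Theorems.Prop7Lane2FamilyRows

open Literature.MathematicalPhysics.QuantumFieldTheory.Balaban1983to89
open Literature.MathematicalPhysics.QuantumFieldTheory.Balaban1983to89.T3ContinuumYM3Torus
open B10Eq27TorusAxialLog (unitsField toUField)
open B9Eq39Adjoint (curl)
open B9TorusCalculus (torusT)
open B10StarCount (shift_unshift unshift_shift)
open B11Eq103H1Complex (SiteL2K BondL2K)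
open Summit.QuantumFields.YangMills.Theorems.Prop7SectET3Transport (periodsT3)
open Summit.QuantumFields.YangMills.Theorems.Prop7SectET3HilbertLetters (W₂ toL2 toL2S DL2 DstarL2 covLapSite)
open Summit.QuantumFields.YangMills.Theorems.Prop7Lane2OverlapRows (norm_sq_sum_le_of_overlap_site norm_sq_sum_le_of_overlap_bond localEnergy_sum_le_of_overlap)
open Summit.QuantumFields.YangMills.Theorems.Prop7Lane2PatchCommutatorRows (gradComm_apply_eq_zero lapComm_apply_eq_zero)
open Summit.QuantumFields.YangMills.Theorems.Prop7DivRecoveryCutoffReadings (norm_sq_siteCutoff_le_norm_sq norm_sq_bondCutoff_le_norm_sq)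
open Finset

variable (F : T3Family) (n K : ℕ) (c₀ : ℝ) [Fact (0 < c₀)]

/-! ## §1 Counting: at most `8` cutoffs alive at a site ⇒ at most `8·#Y` alive somewhere on a finite set `Y` of sites -/

section Counting

variable {F K}
variable (ζ : Site (F.P K) 0 → Site (F.P K) 0 → ℝ) (Zc : Finset (Site (F.P K) 0))

/-- Over the WHOLE index type: at most `8` cutoffs are alive at any site (the package's `≤ 8` row on `Zc` plus «`ζ_c = 0` off `Zc`»).
[cite: Balaban1985BackgroundPropagators, (3.19) p.393; Balaban1984PropagatorsII, p.238] -/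
theorem card_alive_le (hoff : ∀ c, c ∉ Zc → ∀ x, ζ c x = 0) (hcard : ∀ x, (Zc.filter (fun c => ζ c x ≠ 0)).card ≤ 8)
    (x : Site (F.P K) 0) : (Finset.univ.filter (fun c => ζ c x ≠ 0)).card ≤ 8 := by
  classical
  refine le_trans (Finset.card_le_card ?_) (hcard x)
  intro c hc
  rw [Finset.mem_filter] at hc ⊢
  refine ⟨?_, hc.2⟩
  by_contra h
  exact hc.2 (hoff c h x)

/-- If a property of a cutoff forces it to be alive somewhere on a finite set `Y` of sites, at most `8·#Y` cutoffs have it. [cite: Balaban1984PropagatorsII, p.238] -/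
theorem card_filter_le_of_alive_on (hoff : ∀ c, c ∉ Zc → ∀ x, ζ c x = 0) (hcard : ∀ x, (Zc.filter (fun c => ζ c x ≠ 0)).card ≤ 8)
    (Pr : Site (F.P K) 0 → Prop) [DecidablePred Pr] (Y : Finset (Site (F.P K) 0)) (hP : ∀ c, Pr c → ∃ y ∈ Y, ζ c y ≠ 0) :
    (Finset.univ.filter Pr).card ≤ 8 * Y.card := by
  classical
  calc (Finset.univ.filter Pr).card
      ≤ (Y.biUnion fun y => Finset.univ.filter fun c => ζ c y ≠ 0).card := by
        refine Finset.card_le_card ?_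
        intro c hc
        rw [Finset.mem_filter] at hc
        obtain ⟨y, hy, hne⟩ := hP c hc.2
        exact Finset.mem_biUnion.2 ⟨y, hy, Finset.mem_filter.2 ⟨Finset.mem_univ _, hne⟩⟩
    _ ≤ ∑ y ∈ Y, (Finset.univ.filter fun c => ζ c y ≠ 0).card := Finset.card_biUnion_le
    _ ≤ ∑ y ∈ Y, 8 := Finset.sum_le_sum fun y _ => card_alive_le ζ Zc hoff hcard y
    _ = 8 * Y.card := by rw [Finset.sum_const, smul_eq_mul, mul_comm]

/-- The one-step neighbourhood `{x, x ± e_μ}` of a site has at most `7` members (`d = 3`). [folklore] -/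
theorem card_nbhd_le (x : Site (F.P K) 0) :
    (insert x ((Finset.univ.image fun μ : Fin (F.P K).d => x.shift μ) ∪ (Finset.univ.image fun μ : Fin (F.P K).d => x.unshift μ))).card ≤ 7 := by
  classical
  have h3 : (Finset.univ : Finset (Fin (F.P K).d)).card ≤ 3 := by
    rw [Finset.card_univ, Fintype.card_fin, T3Family.P_d]
  have h1 : (Finset.univ.image fun μ : Fin (F.P K).d => x.shift μ).card ≤ 3 := Finset.card_image_le.trans h3
  have h2 : (Finset.univ.image fun μ : Fin (F.P K).d => x.unshift μ).card ≤ 3 := Finset.card_image_le.trans h3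
  calc _ ≤ ((Finset.univ.image fun μ : Fin (F.P K).d => x.shift μ) ∪ (Finset.univ.image fun μ : Fin (F.P K).d => x.unshift μ)).card + 1 :=
        Finset.card_insert_le _ _
    _ ≤ ((Finset.univ.image fun μ : Fin (F.P K).d => x.shift μ).card + (Finset.univ.image fun μ : Fin (F.P K).d => x.unshift μ).card) + 1 := by
        gcongr
        exact Finset.card_union_le _ _
    _ ≤ (3 + 3) + 1 := by gcongr
    _ = 7 := by norm_num

/-- The two-step neighbourhood (one-step neighbourhoods of the one-step neighbourhood) has at most `49` members. [folklore] -/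
theorem card_nbhd₂_le (x : Site (F.P K) 0) :
    ((insert x ((Finset.univ.image fun μ : Fin (F.P K).d => x.shift μ) ∪ (Finset.univ.image fun μ : Fin (F.P K).d => x.unshift μ))).biUnion
      fun z => insert z ((Finset.univ.image fun μ : Fin (F.P K).d => z.shift μ) ∪ (Finset.univ.image fun μ : Fin (F.P K).d => z.unshift μ))).card ≤ 49 := by
  classical
  calc _ ≤ ∑ z ∈ insert x ((Finset.univ.image fun μ : Fin (F.P K).d => x.shift μ) ∪ (Finset.univ.image fun μ : Fin (F.P K).d => x.unshift μ)),
          (insert z ((Finset.univ.image fun μ : Fin (F.P K).d => z.shift μ) ∪ (Finset.univ.image fun μ : Fin (F.P K).d => z.unshift μ))).card :=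
        Finset.card_biUnion_le
    _ ≤ ∑ z ∈ insert x ((Finset.univ.image fun μ : Fin (F.P K).d => x.shift μ) ∪ (Finset.univ.image fun μ : Fin (F.P K).d => x.unshift μ)), 7 :=
        Finset.sum_le_sum fun z _ => card_nbhd_le z
    _ ≤ 7 * 7 := by
        rw [Finset.sum_const, smul_eq_mul, mul_comm]
        exact Nat.mul_le_mul_left 7 (card_nbhd_le x)
    _ = 49 := by norm_num

/-- Membership in the one-step neighbourhood: the centre. [folklore] -/
theorem self_mem_nbhd (x : Site (F.P K) 0) :
    x ∈ insert x ((Finset.univ.image fun μ : Fin (F.P K).d => x.shift μ) ∪ (Finset.univ.image fun μ : Fin (F.P K).d => x.unshift μ)) :=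
  Finset.mem_insert_self _ _

/-- Membership in the one-step neighbourhood: `x + e_μ`. [folklore] -/
theorem shift_mem_nbhd (x : Site (F.P K) 0) (μ : Fin (F.P K).d) :
    x.shift μ ∈ insert x ((Finset.univ.image fun μ : Fin (F.P K).d => x.shift μ) ∪ (Finset.univ.image fun μ : Fin (F.P K).d => x.unshift μ)) := by
  classical
  exact Finset.mem_insert_of_mem (Finset.mem_union_left _ (Finset.mem_image.2 ⟨μ, Finset.mem_univ _, rfl⟩))

/-- Membership in the one-step neighbourhood: `x − e_μ`. [folklore] -/
theorem unshift_mem_nbhd (x : Site (F.P K) 0) (μ : Fin (F.P K).d) :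
    x.unshift μ ∈ insert x ((Finset.univ.image fun μ : Fin (F.P K).d => x.shift μ) ∪ (Finset.univ.image fun μ : Fin (F.P K).d => x.unshift μ)) := by
  classical
  exact Finset.mem_insert_of_mem (Finset.mem_union_right _ (Finset.mem_image.2 ⟨μ, Finset.mem_univ _, rfl⟩))

/-- `x` lies in the one-step neighbourhood of `x + e_μ`. [folklore] -/
theorem self_mem_nbhd_shift (x : Site (F.P K) 0) (μ : Fin (F.P K).d) :
    x ∈ insert (x.shift μ) ((Finset.univ.image fun ν : Fin (F.P K).d => (x.shift μ).shift ν) ∪ (Finset.univ.image fun ν : Fin (F.P K).d => (x.shift μ).unshift ν)) := by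
  have h := unshift_mem_nbhd (x.shift μ) μ
  rwa [unshift_shift] at h

/-- `x` lies in the one-step neighbourhood of `x − e_μ`. [folklore] -/
theorem self_mem_nbhd_unshift (x : Site (F.P K) 0) (μ : Fin (F.P K).d) :
    x ∈ insert (x.unshift μ) ((Finset.univ.image fun ν : Fin (F.P K).d => (x.unshift μ).shift ν) ∪ (Finset.univ.image fun ν : Fin (F.P K).d => (x.unshift μ).unshift ν)) := by
  have h := shift_mem_nbhd (x.unshift μ) μ
  rwa [shift_unshift] at h

end Counting

/-! ## §2 ★ The cutoff families `Zs_c(φ_c)`, `Zb_c(g_c)` (rows `SK`, `SΦ`, `Sr`): multiplicity `≤ 8` -/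

section CutoffFamilies

variable {F K}
variable (ζ : Site (F.P K) 0 → Site (F.P K) 0 → ℝ) (Zc : Finset (Site (F.P K) 0))
  (Zs : Site (F.P K) 0 → (SiteL2K ℂ 3 (periodsT3 F K) c₀ W₂ →ₗ[ℂ] SiteL2K ℂ 3 (periodsT3 F K) c₀ W₂))
  (Zb : Site (F.P K) 0 → (BondL2K ℂ 3 (periodsT3 F K) c₀ W₂ →ₗ[ℂ] BondL2K ℂ 3 (periodsT3 F K) c₀ W₂))

/-- ★ **SITE CUTOFF FAMILIES** (rows `SK`, `SΦ`): `‖Σ_c Zs_c(φ_c)‖² ≤ 8·Σ_c ‖Zs_c(φ_c)‖²` — a member is alive at `x` only where `ζ_c(x) ≠ 0`, so at most `8` are.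
[cite: Balaban1985BackgroundPropagators, (3.11) p.392, (3.19) p.393; Balaban1984PropagatorsII, p.238] -/
theorem norm_sq_sum_siteCutoff_le (hoff : ∀ c, c ∉ Zc → ∀ x, ζ c x = 0) (hcard : ∀ x, (Zc.filter (fun c => ζ c x ≠ 0)).card ≤ 8)
    (hZs : ∀ c φ x, (toL2S F K c₀).symm (Zs c φ) x = ζ c x • (toL2S F K c₀).symm φ x)
    (φ : Site (F.P K) 0 → SiteL2K ℂ 3 (periodsT3 F K) c₀ W₂) :
    ‖∑ c, Zs c (φ c)‖ ^ 2 ≤ 8 * ∑ c, ‖Zs c (φ c)‖ ^ 2 := by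
  classical
  have h := norm_sq_sum_le_of_overlap_site F K c₀ Finset.univ (fun c => Zs c (φ c)) 8 (by
    intro x
    refine le_trans (Finset.card_le_card fun c hc => ?_) (card_alive_le ζ Zc hoff hcard x)
    rw [Finset.mem_filter] at hc ⊢
    refine ⟨hc.1, fun h0 => hc.2 ?_⟩
    show (toL2S F K c₀).symm (Zs c (φ c)) x = 0
    rw [hZs, h0, zero_smul])
  exact_mod_cast h

/-- ★ **BOND CUTOFF FAMILIES** (row `Sr`): `‖Σ_c Zb_c(g_c)‖² ≤ 8·Σ_c ‖Zb_c(g_c)‖²` — a member is alive at `b` only where `ζ_c(b₋) ≠ 0`.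
[cite: Balaban1985BackgroundPropagators, (3.11) p.392, (3.19) p.393; Balaban1984PropagatorsII, p.238] -/
theorem norm_sq_sum_bondCutoff_le (hoff : ∀ c, c ∉ Zc → ∀ x, ζ c x = 0) (hcard : ∀ x, (Zc.filter (fun c => ζ c x ≠ 0)).card ≤ 8)
    (hZb : ∀ c f b, (toL2 F K c₀).symm (Zb c f) b = ζ c b.src • (toL2 F K c₀).symm f b)
    (g : Site (F.P K) 0 → BondL2K ℂ 3 (periodsT3 F K) c₀ W₂) :
    ‖∑ c, Zb c (g c)‖ ^ 2 ≤ 8 * ∑ c, ‖Zb c (g c)‖ ^ 2 := by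
  classical
  have h := norm_sq_sum_le_of_overlap_bond F K c₀ Finset.univ (fun c => Zb c (g c)) 8 (by
    intro b
    refine le_trans (Finset.card_le_card fun c hc => ?_) (card_alive_le ζ Zc hoff hcard b.src)
    rw [Finset.mem_filter] at hc ⊢
    refine ⟨hc.1, fun h0 => hc.2 ?_⟩
    show (toL2 F K c₀).symm (Zb c (g c)) b = 0
    rw [hZb, h0, zero_smul])
  exact_mod_cast h

/-- With `0 ≤ ζ ≤ 1` the cutoffs contract, so (row `SΦ` with `Φi := ‖φ_i‖²`) `‖Σ_c Zs_c(φ_c)‖² ≤ 8·Σ_c ‖φ_c‖²`.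
[cite: Balaban1985BackgroundPropagators, (3.19) p.393, (3.26) p.395] -/
theorem norm_sq_sum_siteCutoff_le_sum (hoff : ∀ c, c ∉ Zc → ∀ x, ζ c x = 0) (hcard : ∀ x, (Zc.filter (fun c => ζ c x ≠ 0)).card ≤ 8)
    (hZs : ∀ c φ x, (toL2S F K c₀).symm (Zs c φ) x = ζ c x • (toL2S F K c₀).symm φ x) (h01 : ∀ c x, 0 ≤ ζ c x ∧ ζ c x ≤ 1)
    (φ : Site (F.P K) 0 → SiteL2K ℂ 3 (periodsT3 F K) c₀ W₂) :
    ‖∑ c, Zs c (φ c)‖ ^ 2 ≤ 8 * ∑ c, ‖φ c‖ ^ 2 :=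
  (norm_sq_sum_siteCutoff_le c₀ ζ Zc Zs hoff hcard hZs φ).trans
    (mul_le_mul_of_nonneg_left (Finset.sum_le_sum fun c _ => norm_sq_siteCutoff_le_norm_sq F K c₀ (Zs c) (ζ c) (hZs c) (h01 c) (φ c)) (by norm_num))

/-- With `0 ≤ ζ ≤ 1` (row `Sr` with `ρi := ‖r_i‖²`): `‖Σ_c Zb_c(g_c)‖² ≤ 8·Σ_c ‖g_c‖²`. [cite: Balaban1985BackgroundPropagators, (3.19) p.393, (3.26) p.395] -/
theorem norm_sq_sum_bondCutoff_le_sum (hoff : ∀ c, c ∉ Zc → ∀ x, ζ c x = 0) (hcard : ∀ x, (Zc.filter (fun c => ζ c x ≠ 0)).card ≤ 8)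
    (hZb : ∀ c f b, (toL2 F K c₀).symm (Zb c f) b = ζ c b.src • (toL2 F K c₀).symm f b) (h01 : ∀ c x, 0 ≤ ζ c x ∧ ζ c x ≤ 1)
    (g : Site (F.P K) 0 → BondL2K ℂ 3 (periodsT3 F K) c₀ W₂) :
    ‖∑ c, Zb c (g c)‖ ^ 2 ≤ 8 * ∑ c, ‖g c‖ ^ 2 :=
  (norm_sq_sum_bondCutoff_le c₀ ζ Zc Zb hoff hcard hZb g).trans
    (mul_le_mul_of_nonneg_left (Finset.sum_le_sum fun c _ =>
      norm_sq_bondCutoff_le_norm_sq F K c₀ (Zb c) (fun b => ζ c b.src) (hZb c) (fun b => h01 c b.src) (g c)) (by norm_num))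

end CutoffFamilies

/-! ## §3 ★★ The commutator families (rows `SM`, `SL`): multiplicities `≤ 16` and `≤ 56` -/

section CommutatorFamilies

variable {F K}
variable (ζ : Site (F.P K) 0 → Site (F.P K) 0 → ℝ) (Zc : Finset (Site (F.P K) 0))
  (Zs : Site (F.P K) 0 → (SiteL2K ℂ 3 (periodsT3 F K) c₀ W₂ →ₗ[ℂ] SiteL2K ℂ 3 (periodsT3 F K) c₀ W₂))
  (Zb : Site (F.P K) 0 → (BondL2K ℂ 3 (periodsT3 F K) c₀ W₂ →ₗ[ℂ] BondL2K ℂ 3 (periodsT3 F K) c₀ W₂))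
  (W : GaugeField (F.P K) 0 (Matrix.specialUnitaryGroup (Fin 2) ℂ))

/-- The gradient commutator `D_W(Zs_c φ) − Zb_c(D_W φ)` is alive at a bond only if `ζ_c` is alive at one of its two ends
(✓`Prop7Lane2PatchCommutatorRows.gradComm_apply_eq_zero`). [cite: Balaban1985BackgroundPropagators, (3.3) p.391, (3.100) pp.413–414] -/
theorem gradComm_alive (hZs : ∀ c φ x, (toL2S F K c₀).symm (Zs c φ) x = ζ c x • (toL2S F K c₀).symm φ x)
    (hZb : ∀ c f b, (toL2 F K c₀).symm (Zb c f) b = ζ c b.src • (toL2 F K c₀).symm f b)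
    (c : Site (F.P K) 0) (φ : SiteL2K ℂ 3 (periodsT3 F K) c₀ W₂) (b : PBond (F.P K) 0)
    (hb : (toL2 F K c₀).symm (DL2 F n K c₀ W (Zs c φ) - Zb c (DL2 F n K c₀ W φ)) b ≠ 0) :
    ζ c b.src ≠ 0 ∨ ζ c b.tgt ≠ 0 := by
  by_contra h
  push Not at h
  exact hb (gradComm_apply_eq_zero F n K c₀ (Zs c) (Zb c) (ζ c) (hZs c) (hZb c) W φ b (by rw [h.1, h.2]))

/-- ★★ **THE GRADIENT-COMMUTATOR FAMILY** (row `SM`): `‖Σ_c (D_W(Zs_c φ_c) − Zb_c(D_W φ_c))‖² ≤ 16·Σ_c ‖D_W(Zs_c φ_c) − Zb_c(D_W φ_c)‖²`.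
[cite: Balaban1985BackgroundPropagators, (3.11) p.392, (3.100) pp.413–414; Balaban1984PropagatorsII, p.238] -/
theorem norm_sq_sum_gradComm_le (hoff : ∀ c, c ∉ Zc → ∀ x, ζ c x = 0) (hcard : ∀ x, (Zc.filter (fun c => ζ c x ≠ 0)).card ≤ 8)
    (hZs : ∀ c φ x, (toL2S F K c₀).symm (Zs c φ) x = ζ c x • (toL2S F K c₀).symm φ x)
    (hZb : ∀ c f b, (toL2 F K c₀).symm (Zb c f) b = ζ c b.src • (toL2 F K c₀).symm f b)
    (φ : Site (F.P K) 0 → SiteL2K ℂ 3 (periodsT3 F K) c₀ W₂) :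
    ‖∑ c, (DL2 F n K c₀ W (Zs c (φ c)) - Zb c (DL2 F n K c₀ W (φ c)))‖ ^ 2 ≤ 16 * ∑ c, ‖DL2 F n K c₀ W (Zs c (φ c)) - Zb c (DL2 F n K c₀ W (φ c))‖ ^ 2 := by
  classical
  have h := norm_sq_sum_le_of_overlap_bond F K c₀ Finset.univ (fun c => DL2 F n K c₀ W (Zs c (φ c)) - Zb c (DL2 F n K c₀ W (φ c))) 16 (by
    intro b
    have hY : ({b.src, b.tgt} : Finset (Site (F.P K) 0)).card ≤ 2 := Finset.card_le_two
    refine le_trans (card_filter_le_of_alive_on ζ Zc hoff hcard _ {b.src, b.tgt} fun c hc => ?_) (by omega)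
    rcases gradComm_alive n c₀ ζ Zs Zb W hZs hZb c (φ c) b hc with h | h
    · exact ⟨b.src, by simp, h⟩
    · exact ⟨b.tgt, by simp, h⟩)
  exact_mod_cast h

/-- The Laplacian commutator `Δ_W(Zs_c φ) − Zs_c(Δ_W φ)` is alive at `x` only if `ζ_c` is alive at one of the seven sites `x, x ± e_μ`
(✓`Prop7Lane2PatchCommutatorRows.lapComm_apply_eq_zero`). [cite: Balaban1985BackgroundPropagators, (3.23) p.394, (3.100) pp.413–414] -/
theorem lapComm_alive (hZs : ∀ c φ x, (toL2S F K c₀).symm (Zs c φ) x = ζ c x • (toL2S F K c₀).symm φ x)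
    (c : Site (F.P K) 0) (φ : SiteL2K ℂ 3 (periodsT3 F K) c₀ W₂) (x : Site (F.P K) 0)
    (hx : (toL2S F K c₀).symm (covLapSite F n K c₀ W (Zs c φ) - Zs c (covLapSite F n K c₀ W φ)) x ≠ 0) :
    ∃ y ∈ insert x ((Finset.univ.image fun μ : Fin (F.P K).d => x.shift μ) ∪ (Finset.univ.image fun μ : Fin (F.P K).d => x.unshift μ)), ζ c y ≠ 0 := by
  by_contra h
  push Not at h
  apply hx
  apply lapComm_apply_eq_zero F n K c₀ (Zs c) (ζ c) (hZs c) W φ x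
  intro μ
  have h0 : ζ c x = 0 := h x (self_mem_nbhd x)
  exact ⟨(h _ (shift_mem_nbhd x μ)).trans h0.symm, (h _ (unshift_mem_nbhd x μ)).trans h0.symm⟩

/-- ★★ **THE LAPLACIAN-COMMUTATOR FAMILY** (row `SL`): `‖Σ_c (Δ_W(Zs_c φ_c) − Zs_c(Δ_W φ_c))‖² ≤ 56·Σ_c ‖Δ_W(Zs_c φ_c) − Zs_c(Δ_W φ_c)‖²`.
[cite: Balaban1985BackgroundPropagators, (3.11) p.392, (3.23) p.394, (3.100) pp.413–414; Balaban1984PropagatorsII, p.238] -/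
theorem norm_sq_sum_lapComm_le (hoff : ∀ c, c ∉ Zc → ∀ x, ζ c x = 0) (hcard : ∀ x, (Zc.filter (fun c => ζ c x ≠ 0)).card ≤ 8)
    (hZs : ∀ c φ x, (toL2S F K c₀).symm (Zs c φ) x = ζ c x • (toL2S F K c₀).symm φ x)
    (φ : Site (F.P K) 0 → SiteL2K ℂ 3 (periodsT3 F K) c₀ W₂) :
    ‖∑ c, (covLapSite F n K c₀ W (Zs c (φ c)) - Zs c (covLapSite F n K c₀ W (φ c)))‖ ^ 2 ≤ 56 * ∑ c, ‖covLapSite F n K c₀ W (Zs c (φ c)) - Zs c (covLapSite F n K c₀ W (φ c))‖ ^ 2 := by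
  classical
  have h := norm_sq_sum_le_of_overlap_site F K c₀ Finset.univ (fun c => covLapSite F n K c₀ W (Zs c (φ c)) - Zs c (covLapSite F n K c₀ W (φ c))) 56 (by
    intro x
    refine le_trans (card_filter_le_of_alive_on ζ Zc hoff hcard _ _ fun c hc => lapComm_alive n c₀ ζ Zs W hZs c (φ c) x hc) ?_
    have := card_nbhd_le x
    omega)
  exact_mod_cast h

end CommutatorFamilies

/-! ## §4 ★★★ The local-energy rows (`SHr`, `SHM`): `H f := c₀ℓ²·CURL_HS(f) + ‖D*_W f‖²`, collared multiplicities `≤ 56` and `≤ 392` -/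

section LocalEnergy

variable {F K}

/-- The one-step neighbourhood relation is symmetric. [folklore] -/
theorem mem_nbhd_symm {y z : Site (F.P K) 0} (h : y ∈ insert z ((Finset.univ.image fun μ : Fin (F.P K).d => z.shift μ) ∪ (Finset.univ.image fun μ : Fin (F.P K).d => z.unshift μ))) : z ∈ insert y ((Finset.univ.image fun μ : Fin (F.P K).d => y.shift μ) ∪ (Finset.univ.image fun μ : Fin (F.P K).d => y.unshift μ)) := by
  classical
  simp only [Finset.mem_insert, Finset.mem_union, Finset.mem_image, Finset.mem_univ, true_and] at h ⊢
  rcases h with rfl | ⟨μ, rfl⟩ | ⟨μ, rfl⟩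
  · exact Or.inl rfl
  · exact Or.inr (Or.inr ⟨μ, unshift_shift z μ⟩)
  · exact Or.inr (Or.inl ⟨μ, shift_unshift z μ⟩)

/-- Symmetry of the two-step neighbourhood relation. [folklore] -/
theorem mem_nbhd₂_symm {x y : Site (F.P K) 0} (h : x ∈ (insert y ((Finset.univ.image fun μ : Fin (F.P K).d => y.shift μ) ∪ (Finset.univ.image fun μ : Fin (F.P K).d => y.unshift μ))).biUnion fun z => insert z ((Finset.univ.image fun μ : Fin (F.P K).d => z.shift μ) ∪ (Finset.univ.image fun μ : Fin (F.P K).d => z.unshift μ))) : y ∈ (insert x ((Finset.univ.image fun μ : Fin (F.P K).d => x.shift μ) ∪ (Finset.univ.image fun μ : Fin (F.P K).d => x.unshift μ))).biUnion fun z => insert z ((Finset.univ.image fun μ : Fin (F.P K).d => z.shift μ) ∪ (Finset.univ.image fun μ : Fin (F.P K).d => z.unshift μ)) := by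
  classical
  obtain ⟨z, hz, hxz⟩ := Finset.mem_biUnion.1 h
  exact Finset.mem_biUnion.2 ⟨z, mem_nbhd_symm hxz, mem_nbhd_symm hz⟩

variable (ζ : Site (F.P K) 0 → Site (F.P K) 0 → ℝ) (Zc : Finset (Site (F.P K) 0))
  (Zs : Site (F.P K) 0 → (SiteL2K ℂ 3 (periodsT3 F K) c₀ W₂ →ₗ[ℂ] SiteL2K ℂ 3 (periodsT3 F K) c₀ W₂))
  (Zb : Site (F.P K) 0 → (BondL2K ℂ 3 (periodsT3 F K) c₀ W₂ →ₗ[ℂ] BondL2K ℂ 3 (periodsT3 F K) c₀ W₂))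
  (W : GaugeField (F.P K) 0 (Matrix.specialUnitaryGroup (Fin 2) ℂ))

/-- ★★ **THE LOCAL ENERGY OF A BOND-CUTOFF FAMILY** (row `SHr`): for `H f := c₀·(L^{K−n})²·CURL_HS(f) + ‖D*_W f‖²` (✓`localEnergy_sum_le_of_overlap`'s functional)
`H(Σ_c Zb_c(g_c)) ≤ 56·Σ_c H(Zb_c(g_c))` — the 1-collared support of `Zb_c(g_c)` lies within one step of the alive set of `ζ_c`, a site set of multiplicity `≤ 7·8`.
[cite: Balaban1985BackgroundPropagators, (3.4) p.391, (3.8)–(3.11) p.392, (3.100) pp.413–414; Balaban1984PropagatorsII, p.238] -/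
theorem localEnergy_sum_bondCutoff_le (hoff : ∀ c, c ∉ Zc → ∀ x, ζ c x = 0) (hcard : ∀ x, (Zc.filter (fun c => ζ c x ≠ 0)).card ≤ 8)
    (hZb : ∀ c f b, (toL2 F K c₀).symm (Zb c f) b = ζ c b.src • (toL2 F K c₀).symm f b)
    (g : Site (F.P K) 0 → BondL2K ℂ 3 (periodsT3 F K) c₀ W₂) :
    c₀ * ((F.L : ℝ) ^ (K - n)) ^ 2 * (∑ x : Site (F.P K) 0, ∑ μ : Fin (F.P K).d, ∑ ν' : Fin (F.P K).d,
          (if μ < ν' then ∑ j : Fin 2, ∑ k : Fin 2,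
            ‖(curl (torusT (F.P K) 0) (fun κ z => unitsField (toUField W) ⟨z, κ⟩)
              (fun κ z => (toL2 F K c₀).symm (∑ c, Zb c (g c)) ⟨z, κ⟩) μ ν' x) j k‖ ^ 2 else 0))
        + ‖DstarL2 F n K c₀ W (∑ c, Zb c (g c))‖ ^ 2
      ≤ 56 * ∑ c, (c₀ * ((F.L : ℝ) ^ (K - n)) ^ 2 * (∑ x : Site (F.P K) 0, ∑ μ : Fin (F.P K).d, ∑ ν' : Fin (F.P K).d,
          (if μ < ν' then ∑ j : Fin 2, ∑ k : Fin 2,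
            ‖(curl (torusT (F.P K) 0) (fun κ z => unitsField (toUField W) ⟨z, κ⟩)
              (fun κ z => (toL2 F K c₀).symm (Zb c (g c)) ⟨z, κ⟩) μ ν' x) j k‖ ^ 2 else 0))
        + ‖DstarL2 F n K c₀ W (Zb c (g c))‖ ^ 2) := by
  classical
  have h := localEnergy_sum_le_of_overlap F n K c₀ W Finset.univ (fun c => Zb c (g c))
    (fun c => (Finset.univ.filter fun y => ζ c y ≠ 0).biUnion fun y => insert y ((Finset.univ.image fun μ : Fin (F.P K).d => y.shift μ) ∪ (Finset.univ.image fun μ : Fin (F.P K).d => y.unshift μ))) 56 (by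
      intro c b hb
      have hsrc : ζ c b.src ≠ 0 := by
        intro h0
        apply hb
        show (toL2 F K c₀).symm (Zb c (g c)) b = 0
        rw [hZb, h0, zero_smul]
      have hal : b.src ∈ Finset.univ.filter fun y => ζ c y ≠ 0 := Finset.mem_filter.2 ⟨Finset.mem_univ _, hsrc⟩
      refine ⟨Finset.mem_biUnion.2 ⟨b.src, hal, self_mem_nbhd b.src⟩, fun μ => ⟨?_, ?_⟩⟩
      · exact Finset.mem_biUnion.2 ⟨b.src, hal, shift_mem_nbhd b.src μ⟩
      · exact Finset.mem_biUnion.2 ⟨b.src, hal, unshift_mem_nbhd b.src μ⟩) (by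
      intro x
      refine le_trans (card_filter_le_of_alive_on ζ Zc hoff hcard _ (insert x ((Finset.univ.image fun μ : Fin (F.P K).d => x.shift μ) ∪ (Finset.univ.image fun μ : Fin (F.P K).d => x.unshift μ))) fun c hc => ?_) ?_
      · obtain ⟨y, hy, hxy⟩ := Finset.mem_biUnion.1 hc
        exact ⟨y, mem_nbhd_symm hxy, (Finset.mem_filter.1 hy).2⟩
      · have := card_nbhd_le x
        omega)
  exact_mod_cast h

/-- ★★★ **THE LOCAL ENERGY OF THE GRADIENT-COMMUTATOR FAMILY** (row `SHM`): `H(Σ_c (D_W(Zs_c φ_c) − Zb_c(D_W φ_c))) ≤ 392·Σ_c H(D_W(Zs_c φ_c) − Zb_c(D_W φ_c))`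
— a commutator is alive at `b` only if `ζ_c` is alive at `b₋` or `b₊`, so its 1-collared support lies within two steps of the alive set of `ζ_c` (multiplicity `≤ 49·8`).
[cite: Balaban1985BackgroundPropagators, (3.3)–(3.4) p.391, (3.8)–(3.11) p.392, (3.100) pp.413–414; Balaban1984PropagatorsII, p.238] -/
theorem localEnergy_sum_gradComm_le (hoff : ∀ c, c ∉ Zc → ∀ x, ζ c x = 0) (hcard : ∀ x, (Zc.filter (fun c => ζ c x ≠ 0)).card ≤ 8)
    (hZs : ∀ c φ x, (toL2S F K c₀).symm (Zs c φ) x = ζ c x • (toL2S F K c₀).symm φ x)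
    (hZb : ∀ c f b, (toL2 F K c₀).symm (Zb c f) b = ζ c b.src • (toL2 F K c₀).symm f b)
    (φ : Site (F.P K) 0 → SiteL2K ℂ 3 (periodsT3 F K) c₀ W₂) :
    c₀ * ((F.L : ℝ) ^ (K - n)) ^ 2 * (∑ x : Site (F.P K) 0, ∑ μ : Fin (F.P K).d, ∑ ν' : Fin (F.P K).d,
          (if μ < ν' then ∑ j : Fin 2, ∑ k : Fin 2,
            ‖(curl (torusT (F.P K) 0) (fun κ z => unitsField (toUField W) ⟨z, κ⟩)
              (fun κ z => (toL2 F K c₀).symm (∑ c, (DL2 F n K c₀ W (Zs c (φ c)) - Zb c (DL2 F n K c₀ W (φ c)))) ⟨z, κ⟩) μ ν' x) j k‖ ^ 2 else 0))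
        + ‖DstarL2 F n K c₀ W (∑ c, (DL2 F n K c₀ W (Zs c (φ c)) - Zb c (DL2 F n K c₀ W (φ c))))‖ ^ 2
      ≤ 392 * ∑ c, (c₀ * ((F.L : ℝ) ^ (K - n)) ^ 2 * (∑ x : Site (F.P K) 0, ∑ μ : Fin (F.P K).d, ∑ ν' : Fin (F.P K).d,
          (if μ < ν' then ∑ j : Fin 2, ∑ k : Fin 2,
            ‖(curl (torusT (F.P K) 0) (fun κ z => unitsField (toUField W) ⟨z, κ⟩)
              (fun κ z => (toL2 F K c₀).symm (DL2 F n K c₀ W (Zs c (φ c)) - Zb c (DL2 F n K c₀ W (φ c))) ⟨z, κ⟩) μ ν' x) j k‖ ^ 2 else 0))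
        + ‖DstarL2 F n K c₀ W (DL2 F n K c₀ W (Zs c (φ c)) - Zb c (DL2 F n K c₀ W (φ c)))‖ ^ 2) := by
  classical
  have h := localEnergy_sum_le_of_overlap F n K c₀ W Finset.univ (fun c => DL2 F n K c₀ W (Zs c (φ c)) - Zb c (DL2 F n K c₀ W (φ c)))
    (fun c => (Finset.univ.filter fun y => ζ c y ≠ 0).biUnion fun y => (insert y ((Finset.univ.image fun μ : Fin (F.P K).d => y.shift μ) ∪ (Finset.univ.image fun μ : Fin (F.P K).d => y.unshift μ))).biUnion fun z => insert z ((Finset.univ.image fun μ : Fin (F.P K).d => z.shift μ) ∪ (Finset.univ.image fun μ : Fin (F.P K).d => z.unshift μ))) 392 (by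
      intro c b hb
      -- an alive end `y ∈ {b₋, b₊}` of `ζ_c`, with `b₋` in its one-step neighbourhood
      obtain ⟨y, hy, hby⟩ : ∃ y ∈ Finset.univ.filter (fun y => ζ c y ≠ 0), b.src ∈ insert y ((Finset.univ.image fun μ : Fin (F.P K).d => y.shift μ) ∪ (Finset.univ.image fun μ : Fin (F.P K).d => y.unshift μ)) := by
        rcases gradComm_alive n c₀ ζ Zs Zb W hZs hZb c (φ c) b hb with h | h
        · exact ⟨b.src, Finset.mem_filter.2 ⟨Finset.mem_univ _, h⟩, self_mem_nbhd b.src⟩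
        · exact ⟨b.tgt, Finset.mem_filter.2 ⟨Finset.mem_univ _, h⟩, self_mem_nbhd_shift b.src b.dir⟩
      refine ⟨Finset.mem_biUnion.2 ⟨y, hy, Finset.mem_biUnion.2 ⟨b.src, hby, self_mem_nbhd b.src⟩⟩, fun μ => ⟨?_, ?_⟩⟩
      · exact Finset.mem_biUnion.2 ⟨y, hy, Finset.mem_biUnion.2 ⟨b.src, hby, shift_mem_nbhd b.src μ⟩⟩
      · exact Finset.mem_biUnion.2 ⟨y, hy, Finset.mem_biUnion.2 ⟨b.src, hby, unshift_mem_nbhd b.src μ⟩⟩) (by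
      intro x
      refine le_trans (card_filter_le_of_alive_on ζ Zc hoff hcard _ ((insert x ((Finset.univ.image fun μ : Fin (F.P K).d => x.shift μ) ∪ (Finset.univ.image fun μ : Fin (F.P K).d => x.unshift μ))).biUnion fun z => insert z ((Finset.univ.image fun μ : Fin (F.P K).d => z.shift μ) ∪ (Finset.univ.image fun μ : Fin (F.P K).d => z.unshift μ))) fun c hc => ?_) ?_
      · obtain ⟨y, hy, hxy⟩ := Finset.mem_biUnion.1 hc
        exact ⟨y, mem_nbhd₂_symm hxy, (Finset.mem_filter.1 hy).2⟩
      · have := card_nbhd₂_le x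
        omega)
  exact_mod_cast h

end LocalEnergy

end Summit.QuantumFields.YangMills.Theorems.Prop7Lane2FamilyRows

end
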